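import Mathlib
import Summits.Ventures.HodgeRepro0.P1LatticeIndexOneBridge1
import Summits.Ventures.HodgeRepro0.P1LatticeIndexOneG
import Summits.Ventures.HodgeRepro0.P1LatticeIndexOneH
import Summits.Ventures.HodgeRepro0.P1LatticeIndexOneI

/-!
# P1LatticeIndexOneBridge3 — D13's THEOREM A (proofs/P1-FermatLatticeClosure-v1.2.md l.4, DECLARED STATUS l.4789) at its
INDEX-1 degrees: H_M = L_M AS AN EQUALITY — THE BRIDGES FOR THE NAMESPACES G, H, I of p1 (g27)'s
artefact (pub-hodge-repro0, p1 (g29), 2026-08-30), on the general lemmas of lean/P1LatticeIndexTwoExactHodge.lean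
(the weight identity `conMat_mulVec_oddVec`, `units_ok_of_lists`), Core3's `mem_span_of_mulVec` and Bridge1's pull-back lemma.

Supporting artefact in the sense of ROUTE.md R-5 (finite combinatorics / exact arithmetic only; never the discharge of a
Hodge-theoretic step; record-only).  THE OBJECTS, as p1 (g27)'s artefact lean/P1LatticeIndexOneA–I.lean states them (nine
self-contained files, each with its own copies of the definitions in its own namespace): a `Block` = (a level m′ ∣ M, a unit
translate t, a kind, a base multiset of level m′, the σ parameters p, i); `Block.ms M` = the base translated by t and pulled
back by M/m′ — the multiset {(M/m′)·((t·x) mod m′) mod M}; `Block.ok M` = the page's legitimacy (Lemma 1 (b) of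
proofs/P1-FermatLatticeClosure-v1.2.md: m′ ∣ M, 3 ≤ m′, t a unit mod M, the base a Hodge multiset of level m′ with entries
below m′, and a Hodge 4-multiset / a split Hodge 6-multiset / Aoki's σ_{p,i} by the kind); `oddVec` on lists; `conMat`;
per degree `units_complete_M`, `blocks_ok_M` (the listed blocks are legitimate) and `generated_M` — every s with B_M·s = 0
is an integer combination of the listed blocks' odd vectors (or s = 0 at the 30 degrees where H_M = 0 — the 29 primes
3 … 113 and M = 4): H_M ⊆ L_M.
THIS ARTEFACT adds the other containment, in general, and states the equality: H_M := ker (mulVecLin B_M) and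
L_M := the ℤ-span of the odd vectors of ALL legitimate blocks (`X_L M n`, the page's BLK(M) as a PREDICATE on `Block`,
not the listed set) satisfy H_M = L_M at every one of the 88 index-1 degrees — THEOREM A's «[H_M : L_M] = 1» on the
coordinates a < M/2 as an EQUALITY OF LATTICES (the coordinate M/2 of an even M taken modulo 2e_{M/2}, the page's l.7
bookkeeping, as in every p1 artefact).

THE BRIDGE, per namespace X (one text, the letter substituted): `X_isHodge_to` — their Bool `isHodge` implies the g28
predicate `IsHodge` (entries below the level); `X_ok_isHodge` — a legitimate block's multiset at M is a Hodge multiset of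
level M (the pull-back lemma); `X_L M n` — L_M as a submodule; `X_mem_ker_of_ok` — every legitimate block's odd vector
(their `oddVec` on the list = the g28 `oddVec` on the coerced multiset, `Multiset.coe_count`) satisfies every weight
constraint (their `conMat` IS the g28 `conMat`, definitionally); `X_span_le_ker` — L_M ≤ H_M; `X_ker_le_span` /
`X_ker_le_span_of_zero` — H_M ≤ L_M from `generated_M` (every row of `genMat M blocks g n` is the odd vector of a listed,
hence legitimate, block; or s = 0).  The per-degree equalities are in lean/P1LatticeIndexOneEqA.lean (the 48 degrees of the
files A–C) and lean/P1LatticeIndexOneEqB.lean (the 40 degrees of D–I).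
NOT formalised: claim(·) for the blocks (Shioda 1981 Thm 4.3 / Lefschetz (1,1), Aoki 1987 Thm 2-1 / Thm 1-4); anything
Hodge-theoretic.
Nothing here asserts anything about whether the statement of README §1 has been proved elsewhere.
-/

namespace HodgeRepro0.P1.P1LatticeIndexTwoExact
open Matrix

/-! ## The bridge for the namespace `P1LatticeIndexOneG` (the degree file G) -/

/-- (G) their Bool Hodge test implies the multiset predicate `IsHodge` (with the entries below the level) -/
theorem G_isHodge_to (mm : ℕ) (x : List ℕ) (h : P1LatticeIndexOneG.isHodge mm x = true) (hlt : ∀ a ∈ x, a < mm) :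
    IsHodge mm (x : Multiset ℕ) := by
  simp only [P1LatticeIndexOneG.isHodge, Bool.and_eq_true, beq_iff_eq, List.all_eq_true, bne_iff_ne, ne_eq,
    List.mem_filter, List.mem_range, decide_eq_true_eq] at h
  obtain ⟨⟨h1, h2⟩, h3⟩ := h
  refine ⟨by rw [Multiset.coe_card, Nat.even_iff]; exact h1, ?_, fun u hu hg => by rw [wt_coe]; exact h3 u ⟨hu, hg⟩⟩
  intro a ha
  rw [Multiset.mem_coe] at ha
  have ha1 := h2 a ha
  refine ⟨?_, hlt a ha⟩
  rcases Nat.eq_zero_or_pos a with h0 | h0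
  · exact absurd (by rw [h0, Nat.zero_mod]) ha1
  · exact h0

/-- (G) a legitimate block's multiset at M is a Hodge multiset of level M (the pull-back lemma) -/
theorem G_ok_isHodge (M : ℕ) (hM : 0 < M) (b : P1LatticeIndexOneG.Block) (h : b.ok M = true) :
    IsHodge M ((b.ms M : List ℕ) : Multiset ℕ) := by
  unfold P1LatticeIndexOneG.Block.ok at h
  simp only [Bool.and_eq_true, beq_iff_eq, decide_eq_true_eq, List.all_eq_true] at h
  obtain ⟨⟨⟨⟨⟨hdiv, h3⟩, ht⟩, hlt⟩, hH⟩, _⟩ := h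
  unfold P1LatticeIndexOneG.Block.ms
  exact isHodge_pullback M b.level b.t b.base hM hdiv (by omega) ht (G_isHodge_to b.level b.base hH hlt)

/-- (G) L_M as a submodule: the ℤ-span of the odd vectors of ALL legitimate blocks of the degree M (the page's BLK(M) as
a PREDICATE — every `Block` passing `Block.ok M`, not the listed ones) on the coordinates a < M/2 -/
abbrev G_L (M n : ℕ) : Submodule ℤ (Fin n → ℤ) :=
  Submodule.span ℤ ((fun ms : List ℕ => (fun a : Fin n => P1LatticeIndexOneG.oddVec M ms a)) ''
    {ms | ∃ b : P1LatticeIndexOneG.Block, b.ok M = true ∧ ms = b.ms M})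

/-- (G) every legitimate block's odd vector satisfies every weight constraint -/
theorem G_mem_ker_of_ok {n u : ℕ} (M : ℕ) (hM : 0 < M) (hn : n = (M - 1) / 2) (unitsF : Fin u → ℕ)
    (hU : ∀ i, unitsF i < M ∧ Nat.gcd (unitsF i) M = 1) (b : P1LatticeIndexOneG.Block) (h : b.ok M = true) :
    P1LatticeIndexOneG.conMat (n := n) M unitsF *ᵥ (fun a => P1LatticeIndexOneG.oddVec M (b.ms M) a) = 0 := by
  have e : (fun a : Fin n => P1LatticeIndexOneG.oddVec M (b.ms M) a) =
      oddVec (n := n) M ((b.ms M : List ℕ) : Multiset ℕ) := by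
    funext a
    simp [P1LatticeIndexOneG.oddVec, oddVec, Multiset.coe_count]
  rw [e]
  exact conMat_mulVec_oddVec M hn unitsF hU _ (G_ok_isHodge M hM b h)

/-- (G) L_M ≤ H_M -/
theorem G_span_le_ker {n u : ℕ} (M : ℕ) (hM : 0 < M) (hn : n = (M - 1) / 2) (unitsF : Fin u → ℕ)
    (hU : ∀ i, unitsF i < M ∧ Nat.gcd (unitsF i) M = 1) :
    G_L M n ≤ LinearMap.ker (Matrix.mulVecLin (P1LatticeIndexOneG.conMat (n := n) M unitsF)) := by
  rw [Submodule.span_le]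
  rintro _ ⟨ms, ⟨b, hb, rfl⟩, rfl⟩
  rw [SetLike.mem_coe, LinearMap.mem_ker, Matrix.mulVecLin_apply]
  exact G_mem_ker_of_ok M hM hn unitsF hU b hb

/-- (G) H_M ≤ L_M from the g27 certificate: every s ∈ H_M is an integer combination of the listed blocks' odd vectors, and
every listed block is legitimate -/
theorem G_ker_le_span {n u g : ℕ} (M : ℕ) (B : Matrix (Fin u) (Fin n) ℤ) (blocks : List P1LatticeIndexOneG.Block)
    (hlen : blocks.length = g) (hok : blocks.all (P1LatticeIndexOneG.Block.ok M) = true)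
    (hgen : ∀ s : Fin n → ℤ, B *ᵥ s = 0 → ∃ c : Fin g → ℤ, s = (P1LatticeIndexOneG.genMat M blocks g n).transpose *ᵥ c) :
    LinearMap.ker (Matrix.mulVecLin B) ≤ G_L M n := by
  intro s hs
  rw [LinearMap.mem_ker, Matrix.mulVecLin_apply] at hs
  obtain ⟨c, hc⟩ := hgen s hs
  rw [hc]
  refine mem_span_of_mulVec _ _ (fun j => ?_) c
  have hj : j.val < blocks.length := by
    rw [hlen]
    exact j.isLt
  have hmem : blocks.getD j.val ⟨3, 1, 0, [], 0, 0⟩ ∈ blocks := by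
    rw [List.getD_eq_getElem _ _ hj]
    exact List.getElem_mem hj
  exact ⟨(blocks.getD j.val ⟨3, 1, 0, [], 0, 0⟩).ms M, ⟨_, (List.all_eq_true.mp hok) _ hmem, rfl⟩, rfl⟩

/-- (G) H_M ≤ L_M at a degree where H_M = 0 -/
theorem G_ker_le_span_of_zero {n u : ℕ} (M : ℕ) (B : Matrix (Fin u) (Fin n) ℤ)
    (hgen : ∀ s : Fin n → ℤ, B *ᵥ s = 0 → s = 0) : LinearMap.ker (Matrix.mulVecLin B) ≤ G_L M n := by
  intro s hs
  rw [LinearMap.mem_ker, Matrix.mulVecLin_apply] at hs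
  rw [hgen s hs]
  exact Submodule.zero_mem _

/-! ## The bridge for the namespace `P1LatticeIndexOneH` (the degree file H) -/

/-- (H) their Bool Hodge test implies the multiset predicate `IsHodge` (with the entries below the level) -/
theorem H_isHodge_to (mm : ℕ) (x : List ℕ) (h : P1LatticeIndexOneH.isHodge mm x = true) (hlt : ∀ a ∈ x, a < mm) :
    IsHodge mm (x : Multiset ℕ) := by
  simp only [P1LatticeIndexOneH.isHodge, Bool.and_eq_true, beq_iff_eq, List.all_eq_true, bne_iff_ne, ne_eq,
    List.mem_filter, List.mem_range, decide_eq_true_eq] at h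
  obtain ⟨⟨h1, h2⟩, h3⟩ := h
  refine ⟨by rw [Multiset.coe_card, Nat.even_iff]; exact h1, ?_, fun u hu hg => by rw [wt_coe]; exact h3 u ⟨hu, hg⟩⟩
  intro a ha
  rw [Multiset.mem_coe] at ha
  have ha1 := h2 a ha
  refine ⟨?_, hlt a ha⟩
  rcases Nat.eq_zero_or_pos a with h0 | h0
  · exact absurd (by rw [h0, Nat.zero_mod]) ha1
  · exact h0

/-- (H) a legitimate block's multiset at M is a Hodge multiset of level M (the pull-back lemma) -/
theorem H_ok_isHodge (M : ℕ) (hM : 0 < M) (b : P1LatticeIndexOneH.Block) (h : b.ok M = true) :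
    IsHodge M ((b.ms M : List ℕ) : Multiset ℕ) := by
  unfold P1LatticeIndexOneH.Block.ok at h
  simp only [Bool.and_eq_true, beq_iff_eq, decide_eq_true_eq, List.all_eq_true] at h
  obtain ⟨⟨⟨⟨⟨hdiv, h3⟩, ht⟩, hlt⟩, hH⟩, _⟩ := h
  unfold P1LatticeIndexOneH.Block.ms
  exact isHodge_pullback M b.level b.t b.base hM hdiv (by omega) ht (H_isHodge_to b.level b.base hH hlt)

/-- (H) L_M as a submodule: the ℤ-span of the odd vectors of ALL legitimate blocks of the degree M (the page's BLK(M) as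
a PREDICATE — every `Block` passing `Block.ok M`, not the listed ones) on the coordinates a < M/2 -/
abbrev H_L (M n : ℕ) : Submodule ℤ (Fin n → ℤ) :=
  Submodule.span ℤ ((fun ms : List ℕ => (fun a : Fin n => P1LatticeIndexOneH.oddVec M ms a)) ''
    {ms | ∃ b : P1LatticeIndexOneH.Block, b.ok M = true ∧ ms = b.ms M})

/-- (H) every legitimate block's odd vector satisfies every weight constraint -/
theorem H_mem_ker_of_ok {n u : ℕ} (M : ℕ) (hM : 0 < M) (hn : n = (M - 1) / 2) (unitsF : Fin u → ℕ)
    (hU : ∀ i, unitsF i < M ∧ Nat.gcd (unitsF i) M = 1) (b : P1LatticeIndexOneH.Block) (h : b.ok M = true) :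
    P1LatticeIndexOneH.conMat (n := n) M unitsF *ᵥ (fun a => P1LatticeIndexOneH.oddVec M (b.ms M) a) = 0 := by
  have e : (fun a : Fin n => P1LatticeIndexOneH.oddVec M (b.ms M) a) =
      oddVec (n := n) M ((b.ms M : List ℕ) : Multiset ℕ) := by
    funext a
    simp [P1LatticeIndexOneH.oddVec, oddVec, Multiset.coe_count]
  rw [e]
  exact conMat_mulVec_oddVec M hn unitsF hU _ (H_ok_isHodge M hM b h)

/-- (H) L_M ≤ H_M -/
theorem H_span_le_ker {n u : ℕ} (M : ℕ) (hM : 0 < M) (hn : n = (M - 1) / 2) (unitsF : Fin u → ℕ)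
    (hU : ∀ i, unitsF i < M ∧ Nat.gcd (unitsF i) M = 1) :
    H_L M n ≤ LinearMap.ker (Matrix.mulVecLin (P1LatticeIndexOneH.conMat (n := n) M unitsF)) := by
  rw [Submodule.span_le]
  rintro _ ⟨ms, ⟨b, hb, rfl⟩, rfl⟩
  rw [SetLike.mem_coe, LinearMap.mem_ker, Matrix.mulVecLin_apply]
  exact H_mem_ker_of_ok M hM hn unitsF hU b hb

/-- (H) H_M ≤ L_M from the g27 certificate: every s ∈ H_M is an integer combination of the listed blocks' odd vectors, and
every listed block is legitimate -/
theorem H_ker_le_span {n u g : ℕ} (M : ℕ) (B : Matrix (Fin u) (Fin n) ℤ) (blocks : List P1LatticeIndexOneH.Block)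
    (hlen : blocks.length = g) (hok : blocks.all (P1LatticeIndexOneH.Block.ok M) = true)
    (hgen : ∀ s : Fin n → ℤ, B *ᵥ s = 0 → ∃ c : Fin g → ℤ, s = (P1LatticeIndexOneH.genMat M blocks g n).transpose *ᵥ c) :
    LinearMap.ker (Matrix.mulVecLin B) ≤ H_L M n := by
  intro s hs
  rw [LinearMap.mem_ker, Matrix.mulVecLin_apply] at hs
  obtain ⟨c, hc⟩ := hgen s hs
  rw [hc]
  refine mem_span_of_mulVec _ _ (fun j => ?_) c
  have hj : j.val < blocks.length := by
    rw [hlen]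
    exact j.isLt
  have hmem : blocks.getD j.val ⟨3, 1, 0, [], 0, 0⟩ ∈ blocks := by
    rw [List.getD_eq_getElem _ _ hj]
    exact List.getElem_mem hj
  exact ⟨(blocks.getD j.val ⟨3, 1, 0, [], 0, 0⟩).ms M, ⟨_, (List.all_eq_true.mp hok) _ hmem, rfl⟩, rfl⟩

/-- (H) H_M ≤ L_M at a degree where H_M = 0 -/
theorem H_ker_le_span_of_zero {n u : ℕ} (M : ℕ) (B : Matrix (Fin u) (Fin n) ℤ)
    (hgen : ∀ s : Fin n → ℤ, B *ᵥ s = 0 → s = 0) : LinearMap.ker (Matrix.mulVecLin B) ≤ H_L M n := by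
  intro s hs
  rw [LinearMap.mem_ker, Matrix.mulVecLin_apply] at hs
  rw [hgen s hs]
  exact Submodule.zero_mem _

/-! ## The bridge for the namespace `P1LatticeIndexOneI` (the degree file I) -/

/-- (I) their Bool Hodge test implies the multiset predicate `IsHodge` (with the entries below the level) -/
theorem I_isHodge_to (mm : ℕ) (x : List ℕ) (h : P1LatticeIndexOneI.isHodge mm x = true) (hlt : ∀ a ∈ x, a < mm) :
    IsHodge mm (x : Multiset ℕ) := by
  simp only [P1LatticeIndexOneI.isHodge, Bool.and_eq_true, beq_iff_eq, List.all_eq_true, bne_iff_ne, ne_eq,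
    List.mem_filter, List.mem_range, decide_eq_true_eq] at h
  obtain ⟨⟨h1, h2⟩, h3⟩ := h
  refine ⟨by rw [Multiset.coe_card, Nat.even_iff]; exact h1, ?_, fun u hu hg => by rw [wt_coe]; exact h3 u ⟨hu, hg⟩⟩
  intro a ha
  rw [Multiset.mem_coe] at ha
  have ha1 := h2 a ha
  refine ⟨?_, hlt a ha⟩
  rcases Nat.eq_zero_or_pos a with h0 | h0
  · exact absurd (by rw [h0, Nat.zero_mod]) ha1
  · exact h0

/-- (I) a legitimate block's multiset at M is a Hodge multiset of level M (the pull-back lemma) -/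
theorem I_ok_isHodge (M : ℕ) (hM : 0 < M) (b : P1LatticeIndexOneI.Block) (h : b.ok M = true) :
    IsHodge M ((b.ms M : List ℕ) : Multiset ℕ) := by
  unfold P1LatticeIndexOneI.Block.ok at h
  simp only [Bool.and_eq_true, beq_iff_eq, decide_eq_true_eq, List.all_eq_true] at h
  obtain ⟨⟨⟨⟨⟨hdiv, h3⟩, ht⟩, hlt⟩, hH⟩, _⟩ := h
  unfold P1LatticeIndexOneI.Block.ms
  exact isHodge_pullback M b.level b.t b.base hM hdiv (by omega) ht (I_isHodge_to b.level b.base hH hlt)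

/-- (I) L_M as a submodule: the ℤ-span of the odd vectors of ALL legitimate blocks of the degree M (the page's BLK(M) as
a PREDICATE — every `Block` passing `Block.ok M`, not the listed ones) on the coordinates a < M/2 -/
abbrev I_L (M n : ℕ) : Submodule ℤ (Fin n → ℤ) :=
  Submodule.span ℤ ((fun ms : List ℕ => (fun a : Fin n => P1LatticeIndexOneI.oddVec M ms a)) ''
    {ms | ∃ b : P1LatticeIndexOneI.Block, b.ok M = true ∧ ms = b.ms M})

/-- (I) every legitimate block's odd vector satisfies every weight constraint -/
theorem I_mem_ker_of_ok {n u : ℕ} (M : ℕ) (hM : 0 < M) (hn : n = (M - 1) / 2) (unitsF : Fin u → ℕ)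
    (hU : ∀ i, unitsF i < M ∧ Nat.gcd (unitsF i) M = 1) (b : P1LatticeIndexOneI.Block) (h : b.ok M = true) :
    P1LatticeIndexOneI.conMat (n := n) M unitsF *ᵥ (fun a => P1LatticeIndexOneI.oddVec M (b.ms M) a) = 0 := by
  have e : (fun a : Fin n => P1LatticeIndexOneI.oddVec M (b.ms M) a) =
      oddVec (n := n) M ((b.ms M : List ℕ) : Multiset ℕ) := by
    funext a
    simp [P1LatticeIndexOneI.oddVec, oddVec, Multiset.coe_count]
  rw [e]
  exact conMat_mulVec_oddVec M hn unitsF hU _ (I_ok_isHodge M hM b h)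

/-- (I) L_M ≤ H_M -/
theorem I_span_le_ker {n u : ℕ} (M : ℕ) (hM : 0 < M) (hn : n = (M - 1) / 2) (unitsF : Fin u → ℕ)
    (hU : ∀ i, unitsF i < M ∧ Nat.gcd (unitsF i) M = 1) :
    I_L M n ≤ LinearMap.ker (Matrix.mulVecLin (P1LatticeIndexOneI.conMat (n := n) M unitsF)) := by
  rw [Submodule.span_le]
  rintro _ ⟨ms, ⟨b, hb, rfl⟩, rfl⟩
  rw [SetLike.mem_coe, LinearMap.mem_ker, Matrix.mulVecLin_apply]
  exact I_mem_ker_of_ok M hM hn unitsF hU b hb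

/-- (I) H_M ≤ L_M from the g27 certificate: every s ∈ H_M is an integer combination of the listed blocks' odd vectors, and
every listed block is legitimate -/
theorem I_ker_le_span {n u g : ℕ} (M : ℕ) (B : Matrix (Fin u) (Fin n) ℤ) (blocks : List P1LatticeIndexOneI.Block)
    (hlen : blocks.length = g) (hok : blocks.all (P1LatticeIndexOneI.Block.ok M) = true)
    (hgen : ∀ s : Fin n → ℤ, B *ᵥ s = 0 → ∃ c : Fin g → ℤ, s = (P1LatticeIndexOneI.genMat M blocks g n).transpose *ᵥ c) :
    LinearMap.ker (Matrix.mulVecLin B) ≤ I_L M n := by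
  intro s hs
  rw [LinearMap.mem_ker, Matrix.mulVecLin_apply] at hs
  obtain ⟨c, hc⟩ := hgen s hs
  rw [hc]
  refine mem_span_of_mulVec _ _ (fun j => ?_) c
  have hj : j.val < blocks.length := by
    rw [hlen]
    exact j.isLt
  have hmem : blocks.getD j.val ⟨3, 1, 0, [], 0, 0⟩ ∈ blocks := by
    rw [List.getD_eq_getElem _ _ hj]
    exact List.getElem_mem hj
  exact ⟨(blocks.getD j.val ⟨3, 1, 0, [], 0, 0⟩).ms M, ⟨_, (List.all_eq_true.mp hok) _ hmem, rfl⟩, rfl⟩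

/-- (I) H_M ≤ L_M at a degree where H_M = 0 -/
theorem I_ker_le_span_of_zero {n u : ℕ} (M : ℕ) (B : Matrix (Fin u) (Fin n) ℤ)
    (hgen : ∀ s : Fin n → ℤ, B *ᵥ s = 0 → s = 0) : LinearMap.ker (Matrix.mulVecLin B) ≤ I_L M n := by
  intro s hs
  rw [LinearMap.mem_ker, Matrix.mulVecLin_apply] at hs
  rw [hgen s hs]
  exact Submodule.zero_mem _

end HodgeRepro0.P1.P1LatticeIndexTwoExact
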